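import Summits.CriticalPhenomena.PercolationContinuityZ3.Theorems.PercNearOneGluingAdditiveGluingCSHHpart
import Literature.Probability.Percolation.TwoSetConditionalAssociationRC
import HarnessLib

/-!
# FK sub-lane: (K6) — covariance transfer across a relay SET — for the random-cluster measure `φ_{w,q}`, every `q ≥ 1`

Support file (`--supports stmt-CriticalPhenomena-4575`), FK sub-lane `prim-bschramm-fk-2` (gen 2) of the post-continuity programme;
builds on p205010 (kernel theorem, internal audit signed; external expert review pending).  No named facts, no sorries, no definitions;
standard axioms.

Link (B2) of the CSH chain (bschramm/FK-Q2.md §2; CHAIN-READ §3.5) is the world-by-world input (K6) of Lemma H: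
  (K6)  for `x ∈ S`, `v ∉ S` arbitrary, `g` monotone on edge sets, `m = ∫ g(C_x)`, `D = {v ↮ S}`:
        `μ(D ∩ {o ↔ v})·(∫_{v ↔ S} g(C_x) − μ(v ↔ S)·m) ≤ μ(D)·(∫_{o ↔ S} g(C_x) − μ(o ↔ S)·m)`.
At `q = 1` this is `CSH.covTransfer_relaySet_edge` (Harris + van den Berg–Häggström–Kahn Thm 1.4 with the vertex set `S`).  THIS FILE proves
the same statement with `prodBernoulli w` replaced by `rcMeasureW w q ∅` for every `q ≥ 1` (`FK.covTransfer_relaySet_edge_rc`), by the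
same proof: Harris becomes the FKG inequality for `φ_{𝐩,q}` (`BHK2006_rcMeasureW_integral_mul_le`, Grimmett Thm (3.8)(b)) and vdBHK Thm 1.4
with sets becomes its random-cluster version `BHK2006_twoSetConditionalAssociation_rc_negCorrelation` (vdBHK Thm 2.1, tree).  Also
`FK.setIntegral_edgeFun_ge_rc` (Harris in integral form for an edge-cluster functional under `φ_{𝐩,q}`).  So row (B2)'s FK status in
FK-Q2 §2 ("ALL IN PRINT for FK q ≥ 1") is now a tree theorem.
[cite: VandenbergHaggstromKahn2005, Thm. 1.4 (p. 7), Thm. 2.1 (p. 9)] [cite: Grimmett2006, Thm. (3.8)(b); §1.4 eq. (1.20) (p. 15)]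
-/

noncomputable section

namespace Summit.CriticalPhenomena.PercolationContinuityZ3.Theorems.FK

open MeasureTheory Set
open Literature.Probability.LatticeModels
open Literature.Probability.Percolation Literature.Probability.Percolation.KNPreFKG
open Literature.Probability.Percolation.BHK2006 (openEdgeCluster_mono)
open scoped Classical

variable {V : Type*} [Fintype V]

/-- **Harris / FKG in integral form for `φ_{𝐩,q}`, `q ≥ 1`, edge-cluster functional**: for `g` monotone on edge sets and an increasing
event `U`, `φ(U)·∫ g(C_a) dφ ≤ ∫_U g(C_a) dφ`. [cite: Grimmett2006, Thm. (3.8)(b)] -/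
theorem setIntegral_edgeFun_ge_rc (w : Sym2 V → unitInterval) {q : ℝ} (hq : 1 ≤ q) (a : V) (g : Set (Sym2 V) → ℝ)
    (hg : Monotone g) (U : Set (BondConfig V)) (hU : IsUpperSet U) :
    (rcMeasureW w q ∅).real U * ∫ ω, g (openEdgeCluster ω a) ∂(rcMeasureW w q ∅) ≤
      ∫ ω in U, g (openEdgeCluster ω a) ∂(rcMeasureW w q ∅) := by
  have hUm : MeasurableSet U := MeasurableSet.of_discrete
  have hfmono : Monotone (U.indicator (1 : BondConfig V → ℝ)) := monotone_indicator_one_of_isUpperSet hU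
  have hgmono : Monotone (fun ω : BondConfig V => g (openEdgeCluster ω a)) := fun ω ω' h => hg (openEdgeCluster_mono h a)
  have key := BHK2006_rcMeasureW_integral_mul_le w hq hfmono hgmono
  rw [integral_indicator_one hUm] at key
  have hprod : ∫ ω, U.indicator (1 : BondConfig V → ℝ) ω * g (openEdgeCluster ω a) ∂(rcMeasureW w q ∅) =
      ∫ ω in U, g (openEdgeCluster ω a) ∂(rcMeasureW w q ∅) := by
    rw [← integral_indicator hUm]
    refine integral_congr_ae (Filter.Eventually.of_forall fun ω => ?_)
    by_cases hω : ω ∈ U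
    · simp only [Set.indicator_of_mem hω, Pi.one_apply, one_mul]
    · simp only [Set.indicator_of_notMem hω, zero_mul]
  rw [hprod] at key
  exact key

/-- **(K6) for `φ_{𝐩,q}`, `q ≥ 1` — covariance transfer across a set.**  For `x ∈ S`, `g` monotone on edge sets, `m = ∫ g(C_x) dφ`,
`D = {v ↮ S}`:  `φ(D ∩ {o ↔ v})·(∫_{v ↔ S} g(C_x) − φ(v ↔ S)·m) ≤ φ(D)·(∫_{o ↔ S} g(C_x) − φ(o ↔ S)·m)`, `φ = rcMeasureW w q ∅`
(FKG for `φ_{𝐩,q}` + vdBHK Thm 2.1 negative correlation with the vertex set `S`; the `q = 1` case is `CSH.covTransfer_relaySet_edge`).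
[cite: VandenbergHaggstromKahn2005, Thm. 2.1 (p. 9), Thm. 1.4 (p. 7)] [cite: Grimmett2006, Thm. (3.8)(b)] -/
theorem covTransfer_relaySet_edge_rc (w : Sym2 V → unitInterval) {q : ℝ} (hq : 1 ≤ q) (S : Finset V) (o v x : V) (hxS : x ∈ S)
    (g : Set (Sym2 V) → ℝ) (hg : Monotone g) :
    (rcMeasureW w q ∅).real ({ω : BondConfig V | ∀ t ∈ S, ¬ (openGraph ω).Reachable v t} ∩ openConn o v) *
        (∫ ω in (⋃ t ∈ S, openConn v t), g (openEdgeCluster ω x) ∂(rcMeasureW w q ∅) -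
          (rcMeasureW w q ∅).real (⋃ t ∈ S, openConn v t) * ∫ ω, g (openEdgeCluster ω x) ∂(rcMeasureW w q ∅)) ≤
      (rcMeasureW w q ∅).real {ω : BondConfig V | ∀ t ∈ S, ¬ (openGraph ω).Reachable v t} *
        (∫ ω in (⋃ t ∈ S, openConn o t), g (openEdgeCluster ω x) ∂(rcMeasureW w q ∅) -
          (rcMeasureW w q ∅).real (⋃ t ∈ S, openConn o t) * ∫ ω, g (openEdgeCluster ω x) ∂(rcMeasureW w q ∅)) := by
  haveI := isProbabilityMeasure_rcMeasureW w (one_pos.trans_le hq) (∅ : Set V)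
  set μ := rcMeasureW w q ∅ with hμ
  set f : BondConfig V → ℝ := fun ω => g (openEdgeCluster ω x) with hf
  set m : ℝ := ∫ ω, f ω ∂μ with hm
  have hmeas : ∀ T : Set (BondConfig V), MeasurableSet T := fun _ => MeasurableSet.of_discrete
  have hint : ∀ (k : BondConfig V → ℝ) (T : Set (BondConfig V)), IntegrableOn k T μ :=
    fun k T => (Integrable.of_finite).integrableOn
  have hn := fun (T : Set (BondConfig V)) => (measureReal_nonneg : 0 ≤ μ.real T)
  set D : Set (BondConfig V) := {ω | ∀ t ∈ S, ¬ (openGraph ω).Reachable v t} with hD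
  set OT : Set (BondConfig V) := ⋃ t ∈ S, openConn o t with hOT
  set Ov : Set (BondConfig V) := openConn o v with hOv
  set Q : Set (BondConfig V) := ⋃ t ∈ S, openConn v t with hQ
  set U : Set (BondConfig V) := OT ∪ Ov with hU
  -- (1) FKG on `U`
  have hupT : IsUpperSet OT := isUpperSet_iUnion₂ fun t _ => isUpperSet_openConn o t
  have hHarris : μ.real U * m ≤ ∫ ω in U, f ω ∂μ :=
    setIntegral_edgeFun_ge_rc w hq x g hg U (hupT.union (isUpperSet_openConn o v))
  -- (2) two-set BHK for `φ_{𝐩,q}`: `g(C_x)` (increasing in `C_S`) and `{o ↔ v}` (increasing in `C_v`) are negatively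
  -- correlated given `v ↮ S`
  have hind : ∀ ω : BondConfig V, (connFamily v o).indicator (1 : Set (Sym2 V) → ℝ) (⋃ s ∈ ({v} : Set V), openEdgeCluster ω s) =
      Ov.indicator (1 : BondConfig V → ℝ) ω := fun ω => by
    rw [biUnion_singleton, congrFun (indicator_comp_openEdgeCluster (connFamily v o) v) ω, ← openConn_eq_setOf_connFamily,
      openConn_symm v o]
  have hprod : ∀ (T : Set (BondConfig V)) (k : BondConfig V → ℝ),
      ∫ ω in D, T.indicator (1 : BondConfig V → ℝ) ω * k ω ∂μ = ∫ ω in D ∩ T, k ω ∂μ := by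
    intro T k
    rw [← setIntegral_mul_indicator_one μ D T k]
    refine setIntegral_congr_fun (hmeas D) fun ω _ => ?_
    ring
  have hDset : {ω : BondConfig V | ∀ s ∈ ({v} : Set V), ∀ t ∈ (↑S : Set V), ¬ (openGraph ω).Reachable s t} = D := by
    ext ω; simp [hD]
  have hGmono : Monotone (fun W : Set (Sym2 V) => g (openEdgeCluster W x)) := fun W W' h => hg (openEdgeCluster_mono h x)
  have hGval : ∀ ω : BondConfig V, g (openEdgeCluster (⋃ t ∈ (↑S : Set V), openEdgeCluster ω t) x) = f ω := fun ω => by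
    simp only [hf]; rw [CovTauStarN.openEdgeCluster_biUnion_eq (Finset.mem_coe.2 hxS)]
  have hBHK := BHK2006_twoSetConditionalAssociation_rc_negCorrelation w hq ({v} : Set V) (↑S : Set V)
    ((connFamily v o).indicator 1) (fun W => g (openEdgeCluster W x))
    (monotone_indicator_one_of_isUpperSet (isUpperSet_connFamily v o)) hGmono
  simp only [hDset, hind, hGval] at hBHK
  rw [setIntegral_indicator_one_eq, hprod Ov] at hBHK
  change μ.real D * ∫ ω in D ∩ Ov, f ω ∂μ ≤ μ.real (D ∩ Ov) * ∫ ω in D, f ω ∂μ at hBHK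
  -- (3) `U = OT ⊔ (D ∩ Ov)`
  have hUdiff : U \ OT = D ∩ Ov := by
    ext ω
    simp only [hU, hOT, hOv, hD, mem_sdiff, mem_union, mem_iUnion, mem_inter_iff, exists_prop, not_exists, not_and, openConn,
      mem_setOf_eq]
    constructor
    · rintro ⟨h | h, hno⟩
      · obtain ⟨t, ht, h'⟩ := h; exact absurd h' (hno t ht)
      · exact ⟨fun t ht hvt => hno t ht (h.trans hvt), h⟩
    · rintro ⟨hd, hov⟩
      exact ⟨Or.inr hov, fun t ht hot => hd t ht (hov.symm.trans hot)⟩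
  have hUint : ∫ ω in U, f ω ∂μ = ∫ ω in OT, f ω ∂μ + ∫ ω in D ∩ Ov, f ω ∂μ := by
    rw [← integral_inter_add_sdiff (hmeas OT) (hint f U), inter_eq_right.2 subset_union_left, hUdiff]
  have hUμ : μ.real U = μ.real OT + μ.real (D ∩ Ov) := by
    rw [← measureReal_inter_add_sdiff (s := U) (h := measure_ne_top _ _) (hmeas OT), inter_eq_right.2 subset_union_left, hUdiff]
  -- (4) `D = Qᶜ`
  have hDQ : D = Qᶜ := by
    ext ω
    simp [hD, hQ, openConn]
  have hDint : ∫ ω in D, f ω ∂μ = m - ∫ ω in Q, f ω ∂μ := by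
    have := integral_add_compl (hmeas Q) (Integrable.of_finite (f := f) (μ := μ))
    rw [← hDQ] at this
    linarith
  have hDμ : μ.real D = 1 - μ.real Q := by
    have h1 : μ.real (univ : Set (BondConfig V)) = μ.real (univ ∩ Q) + μ.real (univ \ Q) :=
      (measureReal_inter_add_sdiff (s := univ) (h := measure_ne_top _ _) (hmeas Q)).symm
    rw [probReal_univ, univ_inter, ← compl_eq_univ_sdiff, ← hDQ] at h1
    linarith
  -- assemble
  have hA : ∫ ω in OT, f ω ∂μ - μ.real OT * m ≥ μ.real (D ∩ Ov) * m - ∫ ω in D ∩ Ov, f ω ∂μ := by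
    rw [hUint, hUμ] at hHarris
    linarith
  have hB : μ.real D * (μ.real (D ∩ Ov) * m - ∫ ω in D ∩ Ov, f ω ∂μ) ≥
      μ.real D * (μ.real (D ∩ Ov) * m) - μ.real (D ∩ Ov) * ∫ ω in D, f ω ∂μ := by
    rw [mul_sub]
    linarith [hBHK]
  have hC := mul_le_mul_of_nonneg_left hA (hn D)
  rw [hDint, hDμ] at hB
  rw [hDμ] at hC ⊢
  nlinarith [hB, hC, hn (D ∩ Ov), hn Q]

end Summit.CriticalPhenomena.PercolationContinuityZ3.Theorems.FK

end
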